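import Summits.CriticalPhenomena.PercolationContinuityZ3.Theorems.PercNearOneGluingNoHeavyLowerTailWorstPairExchangeCex

/-!
# `NoHeavyLowerTail` (stmt-CriticalPhenomena-4575) — the UNRESTRICTED relay-deletion step ("MONO-ρ-DS") is FALSE:
# a certified weighted counterexample on seven vertices (kernel no-go `not_monoRhoStepDS`)

Prover `prim-lf-5` (lemma factory #5), `--supports stmt-CriticalPhenomena-4575`.  No named facts, no sorries; the
`def`s are computable checkers and witness data only (pattern of `…MLnaCexChecker.lean`).

The first form of the lossy relay-deletion induction (file `…MonoRhoReduction.lean`, hypothesis `hStep` of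
`noHeavyLowerTail_of_monoRhoStep`; registered and then EXPIRED stub `stub_monoRhoStep`) asked, for EVERY cell
`|A| ≥ j + 3`: if every `A.erase y` satisfies `bad_j ≤ c · I_j(A.erase y; a)` for some `a`, then some `a ∈ A` has
`bad_j(A) ≤ (|A|/(|A|−1)) · c · I_j(A; a)`.  The ttrl2 census (`run/shared/lean/ttrl/monorho/README.md`, RESULT 03:20Z)
refuted it at the ladder cell `(|A|, j) = (6, 3)` on a "ring of glued pairs" (parity mechanism: with glued pairs
`|π(a)|` is even; demoting one relay of a pair makes its partner's count odd).  This file certifies a SMALL member of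
that family in the kernel:

WITNESS (`wit63`, `n = 7`, observer `0`, relays `A = {1,…,6}`, level `j = 3`): glued pairs `12, 34, 56` (weight `1`),
links `23, 45, 16` (weight `9/10`), observer edges `01, 03, 05` (weight `1/10`).  Exact values (all six relays are
equivalent under the symmetries of the instance): `bad_3(A) = 243/100000`, `I_3(A; a) = 981/100000`;
`bad_3(A∖y) = 2763/500000`, `max_{a≠y} I_3(A∖y; a) = 13743/500000` (attained at the partner of `y`).  With
`c = 2763/13743 = 307/1527` the hypothesis of the step holds for every `y`, while
`(6/5)·c·I_3(A; a) = 0.002367… < bad_3(A) = 0.00243` for every `a`: the conclusion fails (loss factor `1.2321 > 6/5`).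

The corrected stub `stub_monoRhoStepLadder` (dichotomy form "CIL witness OR lossy step", ladder cells only; file
`…MonoRhoLadder.lean`) is NOT refuted by this instance (there `bad_3(A) ≤ I_3(A; a)`, a CIL witness exists).
-/

namespace Summit.CriticalPhenomena.PercolationContinuityZ3.Theorems

open MeasureTheory
open Literature.Probability.LatticeModels Literature.Probability.Percolation
open Summit.CriticalPhenomena.PercolationContinuityZ3.Theorems.AdditiveGluing.Negative.Cert

namespace MonoRhoDSCex

/-! ### Witness data -/

/-- The witness: glued pairs `12, 34, 56`, links `23, 45, 16` of weight `9/10`, observer edges `01, 03, 05` of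
weight `1/10`. -/
def wit63 : List (Fin 7 × Fin 7 × ℚ) :=
  [(1, 2, 1), (3, 4, 1), (5, 6, 1), (2, 3, 9/10), (4, 5, 9/10), (1, 6, 9/10), (0, 1, 1/10), (0, 3, 1/10),
    (0, 5, 1/10)]

/-- The listed pairs are distinct. [this file] -/
theorem wit63_nodup : (wPairs wit63).Nodup := by decide

/-- The witness weights lie in `[0, 1]`. [this file] -/
theorem wit63_weights : ∀ e ∈ wit63, 0 ≤ e.2.2 ∧ e.2.2 ≤ 1 := by
  intro e he
  simp only [wit63, List.mem_cons, List.not_mem_nil, or_false] at he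
  rcases he with rfl | rfl | rfl | rfl | rfl | rfl | rfl | rfl | rfl <;> norm_num

/-! ### The two events of the step as `Bool` tests on reach tables -/

/-- Number of vertices of `B` reachable from `x` according to a reach table. -/
def nrel (B : Finset (Fin 7)) (tb : List ℕ) (x : Fin 7) : ℕ :=
  (B.filter fun z : Fin 7 => (tb.getD x.val 0).testBit z.val = true).card

/-- The observer `0` sees between `1` and `3` vertices of `B` ("bad" at level `3` for the relay set `B`). -/
def badB (B : Finset (Fin 7)) (tb : List ℕ) : Bool := decide (1 ≤ nrel B tb 0 ∧ nrel B tb 0 ≤ 3)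

/-- `a` sees at most `3` vertices of `B` ("light" at level `3` for the relay set `B`). -/
def lightB (B : Finset (Fin 7)) (tb : List ℕ) (a : Fin 7) : Bool := decide (nrel B tb a ≤ 3)

/-- Exact weighted count of `badB`. -/
def cntBad (l : List (Fin 7 × Fin 7 × ℚ)) (B : Finset (Fin 7)) : ℚ :=
  ((wtabs 7 l).map fun t => if badB B t.1 then t.2 else 0).sum

/-- Exact weighted count of `lightB`. -/
def cntLight (l : List (Fin 7 × Fin 7 × ℚ)) (B : Finset (Fin 7)) (a : Fin 7) : ℚ :=
  ((wtabs 7 l).map fun t => if lightB B t.1 a then t.2 else 0).sum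

open scoped Classical in
/-- Per-configuration agreement of the reach count. [this file] -/
theorem nrel_reachTable (ω : List (Fin 7 × Fin 7)) (B : Finset (Fin 7)) (x : Fin 7) :
    nrel B (reachTable 7 ω) x =
      (B.filter fun z => (↑(Eset ω) : Set (Sym2 (Fin 7))) ∈ openConn x z).card := by
  unfold nrel
  rw [Finset.filter_congr fun z _ => testBit_reachTable_iff_mem_openConn ω x z]

open scoped Classical in
/-- `bad_3(B) = cntBad`. [this file] -/
theorem real_bad {l : List (Fin 7 × Fin 7 × ℚ)} (hnd : (wPairs l).Nodup)
    (hq : ∀ e ∈ l, 0 ≤ e.2.2 ∧ e.2.2 ≤ 1) (B : Finset (Fin 7)) :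
    (prodBernoulli (wOfList l)).real
        {ω : BondConfig (Fin 7) |
          1 ≤ (B.filter fun x => ω ∈ openConn (0 : Fin 7) x).card ∧
            (B.filter fun x => ω ∈ openConn (0 : Fin 7) x).card ≤ 3} = (cntBad l B : ℝ) := by
  refine WorstPairExchangeCex.real_eq_wcount hnd hq (fun tb => badB B tb) _ fun ω => ?_
  simp only [badB, decide_eq_true_eq, Set.mem_setOf_eq, nrel_reachTable]

open scoped Classical in
/-- `I_3(B; a) = cntLight`. [this file] -/
theorem real_light {l : List (Fin 7 × Fin 7 × ℚ)} (hnd : (wPairs l).Nodup)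
    (hq : ∀ e ∈ l, 0 ≤ e.2.2 ∧ e.2.2 ≤ 1) (B : Finset (Fin 7)) (a : Fin 7) :
    (prodBernoulli (wOfList l)).real
        {ω : BondConfig (Fin 7) | (B.filter fun x => ω ∈ openConn a x).card ≤ 3} = (cntLight l B a : ℝ) := by
  refine WorstPairExchangeCex.real_eq_wcount hnd hq (fun tb => lightB B tb a) _ fun ω => ?_
  simp only [lightB, decide_eq_true_eq, Set.mem_setOf_eq, nrel_reachTable]

/-! ### The arithmetic (exact rational counts over `2⁹` configurations, kernel reduction) -/

/-- The relay set. -/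
def A6 : Finset (Fin 7) := {1, 2, 3, 4, 5, 6}

/-- Hypothesis of the step at the witness with `c = 307/1527`: for each `y`, the partner of `y` is a witness of
`bad_3(A∖y) ≤ c · I_3(A∖y; ·)` (in fact with equality). [this file] -/
theorem facts_hyp :
    cntBad wit63 (A6.erase 1) ≤ 307/1527 * cntLight wit63 (A6.erase 1) 2 ∧
    cntBad wit63 (A6.erase 2) ≤ 307/1527 * cntLight wit63 (A6.erase 2) 1 ∧
    cntBad wit63 (A6.erase 3) ≤ 307/1527 * cntLight wit63 (A6.erase 3) 4 ∧
    cntBad wit63 (A6.erase 4) ≤ 307/1527 * cntLight wit63 (A6.erase 4) 3 ∧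
    cntBad wit63 (A6.erase 5) ≤ 307/1527 * cntLight wit63 (A6.erase 5) 6 ∧
    cntBad wit63 (A6.erase 6) ≤ 307/1527 * cntLight wit63 (A6.erase 6) 5 := by
  decide +kernel

/-- Failure of the conclusion at the witness: `(6/5)·c·I_3(A; a) < bad_3(A)` for every relay `a`. [this file] -/
theorem facts_concl :
    6 / (6 - 1) * (307/1527 : ℚ) * cntLight wit63 A6 1 < cntBad wit63 A6 ∧
    6 / (6 - 1) * (307/1527 : ℚ) * cntLight wit63 A6 2 < cntBad wit63 A6 ∧
    6 / (6 - 1) * (307/1527 : ℚ) * cntLight wit63 A6 3 < cntBad wit63 A6 ∧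
    6 / (6 - 1) * (307/1527 : ℚ) * cntLight wit63 A6 4 < cntBad wit63 A6 ∧
    6 / (6 - 1) * (307/1527 : ℚ) * cntLight wit63 A6 5 < cntBad wit63 A6 ∧
    6 / (6 - 1) * (307/1527 : ℚ) * cntLight wit63 A6 6 < cntBad wit63 A6 := by
  decide +kernel

/-- `A6.card = 6`. [this file] -/
theorem A6_card : A6.card = 6 := by decide

end MonoRhoDSCex

open MonoRhoDSCex
open scoped Classical

/-- **The unrestricted MONO-ρ relay-deletion step is FALSE** (kernel no-go for the expired stub `stub_monoRhoStep`,
i.e. the hypothesis `hStep` of `noHeavyLowerTail_of_monoRhoStep`, stated verbatim): at the seven-vertex witness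
`MonoRhoDSCex.wit63` (three glued relay pairs in a ring of weight-`9/10` links, observer attached with weight `1/10`
to one relay of each pair), level `j = 3`, `A = {1,…,6}`, `c = 307/1527`, every `A.erase y` satisfies
`bad_3 ≤ c · I_3(A.erase y; partner of y)`, but `bad_3(A) = 243/100000 > (6/5)·c·I_3(A; a) = (6/5)(307/1527)(981/100000)`
for every `a ∈ A`.  The ladder/dichotomy stub `stub_monoRhoStepLadder` is unaffected (a CIL witness exists here).
[this file; census run/shared/lean/ttrl/monorho/README.md] -/
theorem not_monoRhoStepDS :
    ¬ (∀ (j n : ℕ) (w : Sym2 (Fin n) → unitInterval) (A : Finset (Fin n)) (o : Fin n) (c : ℝ),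
        o ∉ A → j + 3 ≤ A.card → 0 ≤ c →
        (∀ y ∈ A, ∃ a ∈ A.erase y,
          (prodBernoulli w).real {ω : BondConfig (Fin n) |
              1 ≤ ((A.erase y).filter fun x => ω ∈ openConn o x).card ∧
                ((A.erase y).filter fun x => ω ∈ openConn o x).card ≤ j} ≤
            c * (prodBernoulli w).real {ω : BondConfig (Fin n) |
              ((A.erase y).filter fun x => ω ∈ openConn a x).card ≤ j}) →
        ∃ a ∈ A,
          (prodBernoulli w).real {ω : BondConfig (Fin n) |
              1 ≤ (A.filter fun x => ω ∈ openConn o x).card ∧ (A.filter fun x => ω ∈ openConn o x).card ≤ j} ≤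
            (A.card : ℝ) / ((A.card : ℝ) - 1) * c *
              (prodBernoulli w).real {ω : BondConfig (Fin n) | (A.filter fun x => ω ∈ openConn a x).card ≤ j}) := by
  intro h
  obtain ⟨h1, h2, h3, h4, h5, h6⟩ := facts_hyp
  obtain ⟨g1, g2, g3, g4, g5, g6⟩ := facts_concl
  have hhyp : ∀ y ∈ A6, ∃ a ∈ A6.erase y,
      (prodBernoulli (wOfList wit63)).real {ω : BondConfig (Fin 7) |
          1 ≤ ((A6.erase y).filter fun x => ω ∈ openConn (0 : Fin 7) x).card ∧
            ((A6.erase y).filter fun x => ω ∈ openConn (0 : Fin 7) x).card ≤ 3} ≤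
        (307/1527 : ℝ) * (prodBernoulli (wOfList wit63)).real {ω : BondConfig (Fin 7) |
          ((A6.erase y).filter fun x => ω ∈ openConn a x).card ≤ 3} := by
    intro y hy
    simp only [A6, Finset.mem_insert, Finset.mem_singleton] at hy
    rcases hy with rfl | rfl | rfl | rfl | rfl | rfl
    · refine ⟨2, by decide, ?_⟩
      rw [real_bad wit63_nodup wit63_weights, real_light wit63_nodup wit63_weights]
      have hh := (Rat.cast_le (K := ℝ)).mpr h1; push_cast at hh; exact hh
    · refine ⟨1, by decide, ?_⟩
      rw [real_bad wit63_nodup wit63_weights, real_light wit63_nodup wit63_weights]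
      have hh := (Rat.cast_le (K := ℝ)).mpr h2; push_cast at hh; exact hh
    · refine ⟨4, by decide, ?_⟩
      rw [real_bad wit63_nodup wit63_weights, real_light wit63_nodup wit63_weights]
      have hh := (Rat.cast_le (K := ℝ)).mpr h3; push_cast at hh; exact hh
    · refine ⟨3, by decide, ?_⟩
      rw [real_bad wit63_nodup wit63_weights, real_light wit63_nodup wit63_weights]
      have hh := (Rat.cast_le (K := ℝ)).mpr h4; push_cast at hh; exact hh
    · refine ⟨6, by decide, ?_⟩
      rw [real_bad wit63_nodup wit63_weights, real_light wit63_nodup wit63_weights]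
      have hh := (Rat.cast_le (K := ℝ)).mpr h5; push_cast at hh; exact hh
    · refine ⟨5, by decide, ?_⟩
      rw [real_bad wit63_nodup wit63_weights, real_light wit63_nodup wit63_weights]
      have hh := (Rat.cast_le (K := ℝ)).mpr h6; push_cast at hh; exact hh
  obtain ⟨a, ha, hle⟩ := h 3 7 (wOfList wit63) A6 0 (307/1527) (by decide) (by decide) (by norm_num) hhyp
  rw [real_bad wit63_nodup wit63_weights, real_light wit63_nodup wit63_weights, A6_card] at hle
  have hcast : ((6 : ℕ) : ℝ) / (((6 : ℕ) : ℝ) - 1) * (307/1527 : ℝ) * (cntLight wit63 A6 a : ℝ) =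
      (((6 / (6 - 1) * (307/1527 : ℚ) * cntLight wit63 A6 a : ℚ)) : ℝ) := by
    push_cast; ring
  rw [hcast] at hle
  have hlt : (6 / (6 - 1) * (307/1527 : ℚ) * cntLight wit63 A6 a : ℚ) < cntBad wit63 A6 := by
    simp only [A6, Finset.mem_insert, Finset.mem_singleton] at ha
    rcases ha with rfl | rfl | rfl | rfl | rfl | rfl
    exacts [g1, g2, g3, g4, g5, g6]
  exact absurd hle (not_le.mpr (by exact_mod_cast hlt))

end Summit.CriticalPhenomena.PercolationContinuityZ3.Theorems
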